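import Literature.Computability.Complexity.OccurrenceObstructionsIPPieces
import HarnessLib

/-!
# Ikenmeyer–Panova 2017, Thm. 4.6 (the main positivity theorem) from the square positivity and
# the printed computer calculations

Sibling proofs file (D-0014) of `Literature/Computability/Complexity/OccurrenceObstructionsIP.lean`
(the named fact `ikenmeyerPanova2017_thm_4_6`; conventions as there: `a × b` =
`Nat.Partition.rectangle a b` = `a` rows of length `b`, `ν(N)` = `ν` with a new first row of
`N - |ν|` boxes, everything over `ℂ`). Theorems only; no definition, no statement of the tree is
changed and no named fact is introduced.

Source: C. Ikenmeyer, G. Panova, *Rectangular Kronecker coefficients and plethysms in geometric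
complexity theory*, Adv. Math. 319 (2017) 40–66 = arXiv:1512.03798 (held), §4: Lemma 4.1
(held: Lemma 18), Lemma 4.2 (19), Prop. 4.3 (20), Cor. 4.4 (21), Cor. 4.5 (22), Thm. 4.6 (Thm. 23)
and its proof (pp. 9–12).

## Main result

`ikenmeyerPanova2017_thm_4_6_of_computations`: **IP Thm. 4.6** ("Let `ν ∉ 𝔛` and
`ℓ = max(ℓ(ν)+1, 9)`, `a > 3ℓ^{3/2}`, `b ≥ 3ℓ²` and `|ν| ≤ ab/6`. Then `g(ν(ab), a × b, a × b) > 0`",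
the tree's `ikenmeyerPanova2017_thm_4_6` verbatim) **follows from**
(1) the square positivity `g(k × k, k × k, k × k) > 0` (Bessenrodt–Behns 2004, quoted in IP §1.1;
the tree's named fact `ikenmeyerPanova2017_square_pos`), and
(2) the Kronecker coefficients of `S₄₉` which the printed proof takes from the computer — "The
values at `a = 7` are readily verified by direct computation" (Cor. 4.4; NOT needed here, the tree
derives them: `hookSquare_pos_seven`), "we verify computationally the statement with `h = w = 7`"
and "initial condition `a = 7`, which is verified computationally" (Cor. 4.5), "a finite
calculation shows that `g(ρ(49), 7 × 7, 7 × 7) > 0`" (proof of Thm. 4.6) — rendered as hypotheses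
on shapes against `7 × 7` given by a new first row over an explicit group of columns (see the
docstring of the theorem for the exact list; 34 single shapes and 5 one-parameter families of at
most 46 shapes each).

So, after this file, the named fact `ikenmeyerPanova2017_thm_4_6` (and with it IP Thm. 1.7(b) and
the `n ≥ 3` part of IP Thm. 1.4, `OccurrenceObstructionsIPAssembly.lean`) rests on exactly one
published theorem not in the tree — the square positivity, whose reduction to two values of the
Murnaghan–Nakayama rule is `OccurrenceObstructionsIPSquareProofs.lean` — and on finitely many
explicitly listed Kronecker coefficients of `S₄₉`, for which the tree has no evaluator (no
character values of `S_n`). Neither can be bypassed: each listed shape is itself an instance of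
Thm. 4.6 (a body `ν ∉ 𝔛` against a large frame reduces to the same body against a smaller frame
only through one-row summands, and the bodies listed admit no row-wise splitting into two bodies
outside `𝔛`), and `(k × k)³` admits no row-wise splitting at all.

## The proof (this file; the pieces are in `OccurrenceObstructionsIPPieces.lean`)

Let `λ ⊢ ab` have body `ν = λ̄ ∉ 𝔛`, `L = ℓ(ν)`, and let `C` be the multiset of column lengths of
`ν` (`exists_cols_of_shape`; `C ∉ 𝔛` in column form).
* §1 (`exists_blocks_small`, IP Lemma 4.1 with the grouping of the proof of Thm. 4.6): cut `C` into
  `B_j` blocks of `j + 1` columns of length `j` and a remainder `Small` — keeping one block's worth of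
  columns whenever there is a block (IP's `r_k := r'_k + k`), and one block more if the remainder
  would be exceptional — so that `Small ∉ 𝔛`, `Small ≠ ∅`, `|Small| ≤ L² + 3L + 1`.
* §2 (`exists_blockFrame_pos`, `exists_bulk_pos`, `exists_allBulk_pos`): by Lemma 4.2 (from the square
  positivity) `⌊a/(j+1)⌋` blocks fill a frame `a × (j+1)`; the frames are added with the semigroup
  property (IP's summands (I), (II)).
* `Small` splits into atoms (`exists_atom_decomposition`): good columns (Cor. 4.4, proved), pairs and
  triples of bad columns and six further groups (computed), and the hook families of Cor. 4.5
  (computed base, then the proved Prop. 4.3); each is realised against `w × w`,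
  `w = max(7, ⌊√(L+8)⌋+1)`, and `⌊9ℓ/w⌋` of them are stacked to a frame `a × w`
  (`exists_stacks_pos`; IP's summands (III)–(V), here treated uniformly).
* §3 (`bulk_width_bound`, `width_le`): the widths add up to `M ≤ b` — the bulk costs at most
  `(2|ν| + a Σ_{j ≤ L}(j+1))/(a-ℓ) ≤ 3b/8 + 9(ℓ²+ℓ)/16` (IP: `(|ν|+ν₁)/(a-ℓ) + ℓ(ℓ+1)/2`), the small
  pieces at most `(2ℓ² + 58ℓ + 47)/8`, and `13ℓ² + 125ℓ + 76 ≤ 10b` for `b ≥ 3ℓ²`, `ℓ ≥ 9`.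
* §4: assembly, then growth of the frame `a × M ↦ a × b`.

## References

* C. Ikenmeyer, G. Panova, Adv. Math. 319 (2017) 40–66 = arXiv:1512.03798, §4 (held text
  pp. 9–12). [key `IkenmeyerPanova2017`]
* C. Bessenrodt, C. Behns, J. Algebra 280 (2004) 132–144 (the square positivity, as quoted in
  IP §1.1).

## Mathlib and tree

Mathlib: `Multiset.count`, `Multiset.toFinset_sum_count_nsmul_eq`, `Finset.sum_Ioc_succ_top`,
`Finset.single_le_sum`, `Finset.sum_ite_eq'`, `Nat.sqrt` (`Nat.lt_succ_sqrt`, `Nat.sqrt_le`),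
`Nat.div_add_mod`, `Nat.div_mul_le_self`, `Nat.lt_div_mul_add`, `nlinarith`. Tree:
`ikenmeyerPanova2017_lemma_4_2_of_square_pos` (`…IPSemigroup`), `getD_sortedParts_rectangle`,
`kroneckerCoeff_pos_of_frame_le` (`…IPHookPositivity`), and `OccurrenceObstructionsIPPieces.lean`
(`exists_cols_of_shape`, `exists_atom_decomposition`, `exists_rowSum_pos`, `exists_stacks_pos`,
`exists_hook_pos_sq`, `exists_pos_sq_of_seven`, `exists_pos_sq_of_forall`,
`ikenmeyerPanova2017_cor_4_5_fam*`, `ceilDiv_succ`, `eq`/`card`/`sum` of finite sums of multisets).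
-/

noncomputable section

open scoped BigOperators

namespace Literature.Computability.Complexity

open Literature.NumberTheory.DiophantineGeometry (kroneckerCoeff)

/-! ### §1 Cutting the columns into bulk blocks and a small remainder (IP Lemma 4.1) -/

section Decomposition

/-- A multiset of naturals in `[1, L]` is the sum of its column counts: `C = Σ_{1 ≤ j ≤ L} c_j • {j}`
(IP: "let `c_k` denote the number of columns of length `k - 1`"). [folklore] -/
theorem eq_sum_count_nsmul (C : Multiset ℕ) {L : ℕ} (hC : ∀ x ∈ C, 1 ≤ x ∧ x ≤ L) :
    C = ∑ j ∈ Finset.Ioc 0 L, C.count j • ({j} : Multiset ℕ) := by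
  classical
  conv_lhs => rw [← Multiset.toFinset_sum_count_nsmul_eq C]
  refine Finset.sum_subset (fun x hx => ?_) (fun x _ hx => ?_)
  · rw [Multiset.mem_toFinset] at hx
    rw [Finset.mem_Ioc]
    exact ⟨(hC x hx).1, (hC x hx).2⟩
  · rw [Multiset.mem_toFinset] at hx
    rw [Multiset.count_eq_zero_of_notMem hx, zero_nsmul]

/-- `Σ_{1 ≤ j ≤ L} (2j + 1) = L² + 2L`. [folklore] -/
theorem sum_Ioc_two_mul_add_one (L : ℕ) : ∑ j ∈ Finset.Ioc 0 L, (2 * j + 1) = L * L + 2 * L := by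
  induction L with
  | zero => simp
  | succ L ih => rw [Finset.sum_Ioc_succ_top (Nat.zero_le _), ih]; ring

/-- **Cutting the columns (IP Lemma 4.1 and the grouping of Thm. 4.6).** Let `C` be a nonempty
multiset of column lengths in `[1, L]` other than the six column multisets of `𝔛`. For each length
`j` cut off `B_j` *blocks* of `j + 1` columns of length `j` — greedily, but keeping at least one
block's worth of columns whenever there is a block at all (IP, proof of Lemma 4.1: "We now join (if
possible) one of the `(k-1) × k` rectangles with the `(k-1) × r_k` rectangle"), and one block fewer
if the remainder would be exceptional — so that the remainder `Small` is nonempty, not exceptional,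
and has at most `L² + 3L + 1` columns. [cite: IkenmeyerPanova2017, Lemma 4.1 and Thm. 4.6 (proofs; held: Lemma 18, Thm. 23)] -/
theorem exists_blocks_small (C : Multiset ℕ) {L : ℕ} (hC : ∀ x ∈ C, 1 ≤ x ∧ x ≤ L) (hC0 : C ≠ 0)
    (hCX : C ∉ ({{1}, {2}, {4}, {6}, {1, 2}, {1, 1, 2}} : Finset (Multiset ℕ))) :
    ∃ (B : ℕ → ℕ) (Small : Multiset ℕ),
      C = Small + ∑ j ∈ Finset.Ioc 0 L, ((j + 1) * B j) • ({j} : Multiset ℕ) ∧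
      Small ≠ 0 ∧ Small ∉ ({{1}, {2}, {4}, {6}, {1, 2}, {1, 1, 2}} : Finset (Multiset ℕ)) ∧
      (∀ x ∈ Small, 1 ≤ x ∧ x ≤ L) ∧ Small.card ≤ L * L + 3 * L + 1 ∧
      (∀ j, (j + 1) * B j ≤ C.count j) := by
  classical
  -- the greedy cut keeping one block
  set B₀ : ℕ → ℕ := fun j => if C.count j < j + 1 then 0 else C.count j / (j + 1) - 1 with hB₀
  have hB₀le : ∀ j, (j + 1) * B₀ j ≤ C.count j := by
    intro j
    simp only [hB₀]
    split_ifs with h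
    · simp
    · calc (j + 1) * (C.count j / (j + 1) - 1) ≤ (j + 1) * (C.count j / (j + 1)) :=
            Nat.mul_le_mul_left _ (Nat.sub_le _ _)
        _ ≤ C.count j := Nat.mul_div_le _ _
  set n₀ : ℕ → ℕ := fun j => C.count j - (j + 1) * B₀ j with hn₀
  have hn₀le : ∀ j, n₀ j ≤ 2 * j + 1 := by
    intro j
    simp only [hn₀, hB₀]
    split_ifs with h
    · omega
    · rw [not_lt] at h
      have h1 : 1 ≤ C.count j / (j + 1) := (Nat.le_div_iff_mul_le (Nat.succ_pos j)).2 (by simpa using h)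
      have h2 : (j + 1) * (C.count j / (j + 1)) + C.count j % (j + 1) = C.count j :=
        Nat.div_add_mod (C.count j) (j + 1)
      have h3 : C.count j % (j + 1) < j + 1 := Nat.mod_lt (C.count j) (by omega)
      have h4 : (j + 1) * (C.count j / (j + 1) - 1) + (j + 1) = (j + 1) * (C.count j / (j + 1)) := by
        rw [Nat.mul_sub_one, Nat.sub_add_cancel (Nat.le_mul_of_pos_right _ h1)]
      omega
  -- whenever there is a block, a block's worth of columns is kept
  have hn₀big : ∀ j, 1 ≤ B₀ j → j + 1 ≤ n₀ j := by
    intro j hj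
    simp only [hn₀, hB₀] at hj ⊢
    split_ifs at hj ⊢ with h
    · omega
    · have h2 : (j + 1) * (C.count j / (j + 1)) + C.count j % (j + 1) = C.count j :=
        Nat.div_add_mod (C.count j) (j + 1)
      have h4 : (j + 1) * (C.count j / (j + 1) - 1) + (j + 1) = (j + 1) * (C.count j / (j + 1)) := by
        rw [Nat.mul_sub_one, Nat.sub_add_cancel (Nat.le_mul_of_pos_right _ (by omega))]
      omega
  have hn₀pos : ∀ j, 1 ≤ C.count j → 1 ≤ n₀ j := by
    intro j hj
    by_cases hb : 1 ≤ B₀ j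
    · exact le_trans (by omega) (hn₀big j hb)
    · simp only [hn₀]
      have : B₀ j = 0 := by omega
      rw [this, mul_zero, Nat.sub_zero]; exact hj
  set Small₀ : Multiset ℕ := ∑ j ∈ Finset.Ioc 0 L, n₀ j • ({j} : Multiset ℕ) with hSmall₀
  have hsplit₀ : C = Small₀ + ∑ j ∈ Finset.Ioc 0 L, ((j + 1) * B₀ j) • ({j} : Multiset ℕ) := by
    rw [hSmall₀, ← Finset.sum_add_distrib]
    conv_lhs => rw [eq_sum_count_nsmul C hC]
    refine Finset.sum_congr rfl fun j _ => ?_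
    rw [← add_nsmul]
    congr 1
    simp only [hn₀]
    have := hB₀le j
    omega
  have hmem₀ : ∀ x ∈ Small₀, 1 ≤ x ∧ x ≤ L := by
    intro x hx
    rw [hSmall₀, Multiset.mem_sum] at hx
    obtain ⟨j, hj, hx⟩ := hx
    rw [Multiset.mem_nsmul] at hx
    rw [Multiset.mem_singleton.1 hx.2]
    rw [Finset.mem_Ioc] at hj
    exact ⟨hj.1, hj.2⟩
  have hcard₀ : Small₀.card ≤ L * L + 2 * L := by
    rw [hSmall₀, Multiset.card_sum, ← sum_Ioc_two_mul_add_one]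
    refine Finset.sum_le_sum fun j _ => ?_
    rw [Multiset.card_nsmul, Multiset.card_singleton, mul_one]
    exact hn₀le j
  have hle₀ : ∀ j ∈ Finset.Ioc 0 L, n₀ j • ({j} : Multiset ℕ) ≤ Small₀ := fun j hj =>
    Finset.single_le_sum (f := fun j => n₀ j • ({j} : Multiset ℕ)) (fun i _ => Multiset.zero_le _) hj
  have hSmall₀0 : Small₀ ≠ 0 := by
    obtain ⟨x, hx⟩ := Multiset.exists_mem_of_ne_zero hC0
    have hxI : x ∈ Finset.Ioc 0 L := by rw [Finset.mem_Ioc]; exact ⟨(hC x hx).1, (hC x hx).2⟩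
    have h1 : 1 ≤ n₀ x := hn₀pos x (Multiset.one_le_count_iff_mem.2 hx)
    intro h0
    have := Multiset.card_le_card (hle₀ x hxI)
    rw [h0, Multiset.card_zero, Multiset.card_nsmul, Multiset.card_singleton, mul_one] at this
    omega
  by_cases hX₀ : Small₀ ∉ ({{1}, {2}, {4}, {6}, {1, 2}, {1, 1, 2}} : Finset (Multiset ℕ))
  · exact ⟨B₀, Small₀, hsplit₀, hSmall₀0, hX₀, hmem₀, by omega, hB₀le⟩
  · -- the remainder is exceptional: put one block back
    rw [not_not] at hX₀
    have hblock : ∃ j₀ ∈ Finset.Ioc 0 L, 1 ≤ B₀ j₀ := by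
      by_contra hno
      push Not at hno
      apply hCX
      have hzero : ∑ j ∈ Finset.Ioc 0 L, ((j + 1) * B₀ j) • ({j} : Multiset ℕ) = 0 :=
        Finset.sum_eq_zero fun j hj => by rw [show B₀ j = 0 by have := hno j hj; omega]; simp
      rwa [hsplit₀, hzero, add_zero]
    obtain ⟨j₀, hj₀I, hj₀⟩ := hblock
    have hj₀1 : 1 ≤ j₀ := (Finset.mem_Ioc.1 hj₀I).1
    have hj₀L : j₀ ≤ L := (Finset.mem_Ioc.1 hj₀I).2
    set B : ℕ → ℕ := fun j => if j = j₀ then B₀ j - 1 else B₀ j with hB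
    set Small : Multiset ℕ := Small₀ + (j₀ + 1) • ({j₀} : Multiset ℕ) with hSmall
    have hBle : ∀ j, B j ≤ B₀ j := fun j => by simp only [hB]; split_ifs <;> omega
    have hbulk : ∑ j ∈ Finset.Ioc 0 L, ((j + 1) * B₀ j) • ({j} : Multiset ℕ) =
        (j₀ + 1) • ({j₀} : Multiset ℕ) + ∑ j ∈ Finset.Ioc 0 L, ((j + 1) * B j) • ({j} : Multiset ℕ) := by
      have e : ∀ j ∈ Finset.Ioc 0 L, ((j + 1) * B₀ j) • ({j} : Multiset ℕ) =
          (if j = j₀ then (j₀ + 1) • ({j₀} : Multiset ℕ) else 0) + ((j + 1) * B j) • ({j} : Multiset ℕ) := by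
        intro j _
        simp only [hB]
        split_ifs with h
        · subst h
          rw [← add_nsmul]
          congr 1
          rw [Nat.mul_sub_one, ← Nat.add_sub_assoc (Nat.le_mul_of_pos_right _ (by omega)),
            Nat.add_sub_cancel_left]
        · rw [zero_add]
      rw [Finset.sum_congr rfl e, Finset.sum_add_distrib, Finset.sum_ite_eq' (Finset.Ioc 0 L) j₀,
        if_pos hj₀I]
    refine ⟨B, Small, ?_, ?_, ?_, ?_, ?_, fun j => (Nat.mul_le_mul_left _ (hBle j)).trans (hB₀le j)⟩
    · rw [hsplit₀, hbulk, hSmall, add_assoc]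
    · rw [hSmall]; intro h0; apply hSmall₀0
      rw [← Multiset.le_zero, ← h0]; exact Multiset.le_add_right _ _
    · -- `Small` has at least three columns and is not `{1,1,2}`
      have hc0 : 1 ≤ Small₀.card := Multiset.card_pos.2 hSmall₀0
      have hcS : Small.card = Small₀.card + (j₀ + 1) := by
        rw [hSmall, Multiset.card_add, Multiset.card_nsmul, Multiset.card_singleton, mul_one]
      intro hmem
      simp only [Finset.mem_insert, Finset.mem_singleton] at hmem
      have hc3 : Small.card = 3 ∧ Small = {1, 1, 2} := by
        rcases hmem with h | h | h | h | h | h <;> rw [h] at hcS ⊢ <;> simp at hcS <;> first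
          | omega | exact ⟨by simp, rfl⟩
      obtain ⟨hc3, hS112⟩ := hc3
      have hj₀1' : j₀ = 1 := by omega
      subst hj₀1'
      -- two columns of length 1 were kept, and two more are put back: too many for `{1,1,2}`
      have hkeep : 2 ≤ n₀ 1 := hn₀big 1 hj₀
      have hcount : 4 ≤ Small.count 1 := by
        rw [hSmall, Multiset.count_add, Multiset.count_nsmul, Multiset.count_singleton_self, mul_one]
        have h1 : n₀ 1 ≤ Small₀.count 1 := by
          have := Multiset.count_le_of_le 1 (hle₀ 1 hj₀I)
          rwa [Multiset.count_nsmul, Multiset.count_singleton_self, mul_one] at this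
        omega
      rw [hS112] at hcount
      exact absurd hcount (by decide)
    · intro x hx
      rw [hSmall, Multiset.mem_add] at hx
      rcases hx with hx | hx
      · exact hmem₀ x hx
      · rw [Multiset.mem_nsmul] at hx
        rw [Multiset.mem_singleton.1 hx.2]
        exact ⟨hj₀1, hj₀L⟩
    · rw [hSmall, Multiset.card_add, Multiset.card_nsmul, Multiset.card_singleton, mul_one]
      nlinarith

end Decomposition

/-! ### §2 The bulk: blocks of `j + 1` columns of length `j` against frames `a × (j+1)` -/

section Bulk

/-- The rows of `n` columns of length `j`: `n` in the rows `r < j`, `0` below. [folklore] -/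
theorem card_filter_nsmul_singleton (n j r : ℕ) :
    ((n • ({j} : Multiset ℕ)).filter (r + 1 ≤ ·)).card = if r + 1 ≤ j then n else 0 := by
  rw [Multiset.filter_nsmul, Multiset.card_nsmul]
  by_cases h : r + 1 ≤ j
  · rw [Multiset.filter_eq_self.2 (by simpa using h), Multiset.card_singleton, mul_one, if_pos h]
  · rw [Multiset.filter_eq_nil.2 (by simpa using h), Multiset.card_zero, mul_zero, if_neg h]

/-- **One frame of blocks (IP Lemma 4.2, from the square positivity).** For `k t ≤ a` the shape
`(k × (kt) + (k(a - kt)))` — a new first row over `kt` columns of length `k - 1`, i.e. `t` blocks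
of `k` columns — is positive against `a × k`: "Let `μ = (k × (ks))` and `a ≥ ks`, then
`g(k × (ks) + (k(a-ks)), a × k, a × k) > 0`" (the tree's
`ikenmeyerPanova2017_lemma_4_2_of_square_pos`, granted `g(k × k, k × k, k × k) > 0`).
[cite: IkenmeyerPanova2017, Lemma 4.2 (held: Lemma 19, p. 9)] -/
theorem exists_blockFrame_pos (hsq : ikenmeyerPanova2017_square_pos) {a k t : ℕ}
    (hkt : k * t ≤ a) :
    ∃ mu : Nat.Partition (a * k),
      (∀ r, mu.sortedParts.getD (r + 1) 0 = if r + 1 < k then k * t else 0) ∧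
        0 < kroneckerCoeff ℂ mu (Nat.Partition.rectangle a k) (Nat.Partition.rectangle a k) := by
  set nu := (Nat.Partition.rectangle k (k * t)).rowAdd (Nat.Partition.indiscrete (k * (a - k * t)))
    with hnu
  have e : k * (k * t) + k * (a - k * t) = a * k := by
    rw [← Nat.mul_add, Nat.add_sub_cancel' hkt, mul_comm]
  let mu : Nat.Partition (a * k) := ⟨nu.parts, nu.parts_pos, by rw [nu.parts_sum, e]⟩
  have hsp : mu.sortedParts = nu.sortedParts := sortedParts_congr_parts rfl
  refine ⟨mu, fun r => ?_, ikenmeyerPanova2017_lemma_4_2_of_square_pos hsq hkt mu rfl⟩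
  rw [hsp, hnu, getD_sortedParts_rowAdd, getD_sortedParts_rectangle, getD_sortedParts_indiscrete,
    if_neg (Nat.succ_ne_zero r), add_zero]

/-- **The blocks of one column length, frame by frame.** Granted the square positivity, `B` blocks
of `j + 1` columns of length `j` (`j + 1 ≤ a`), packed `s = ⌊a/(j+1)⌋` to a frame `a × (j+1)`
(`exists_blockFrame_pos`) and the frames added with the semigroup property, are realised against
`a × (j+1)⌈B/s⌉` (IP, proof of Thm. 4.6, summands (I) and (II): "we divide `x_k` by `s_k` to obtain
`x_k = h_k s_k + t_k` … Using the semigroup property for the `h_k` summands").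
[cite: IkenmeyerPanova2017, Thm. 4.6 (proof, eqs. (I), (II); held: Thm. 23, p. 11)] -/
theorem exists_bulk_pos (hsq : ikenmeyerPanova2017_square_pos) {a j : ℕ} (hja : j + 1 ≤ a) :
    ∀ B : ℕ, ∃ mu : Nat.Partition (a * ((j + 1) * ((B + a / (j + 1) - 1) / (a / (j + 1))))),
      (∀ r, mu.sortedParts.getD (r + 1) 0 =
        ((((j + 1) * B) • ({j} : Multiset ℕ)).filter (r + 1 ≤ ·)).card) ∧
        0 < kroneckerCoeff ℂ mu
          (Nat.Partition.rectangle a ((j + 1) * ((B + a / (j + 1) - 1) / (a / (j + 1)))))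
          (Nat.Partition.rectangle a ((j + 1) * ((B + a / (j + 1) - 1) / (a / (j + 1))))) := by
  set s := a / (j + 1) with hs
  have hs1 : 1 ≤ s := (Nat.le_div_iff_mul_le (Nat.succ_pos j)).2 (by simpa using hja)
  intro B
  induction B using Nat.strong_induction_on with
  | _ B ih =>
  rcases Nat.eq_zero_or_pos B with rfl | hB
  · have e : a * ((j + 1) * ((0 + s - 1) / s)) = 0 := by
      rw [Nat.zero_add, Nat.div_eq_of_lt (by omega)]; simp
    refine ⟨⟨0, fun h => by simp at h, by rw [Multiset.sum_zero, e]⟩, fun r => ?_,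
      kroneckerCoeff_pos_of_eq_zero e _ _ _⟩
    simp [Nat.Partition.sortedParts]
  · -- the first frame: `t = min(B, s)` blocks
    set t := B - (B - s) with ht
    have hts : t ≤ s := by omega
    have htB : t + (B - s) = B := by omega
    have hkt : (j + 1) * t ≤ a :=
      (Nat.mul_le_mul_left _ hts).trans (by rw [hs]; exact Nat.mul_div_le a (j + 1))
    obtain ⟨mu₁, hmu₁, hpos₁⟩ := exists_blockFrame_pos hsq hkt
    obtain ⟨mu₂, hmu₂, hpos₂⟩ := ih (B - s) (by omega)
    obtain ⟨mu, hmu, hpos⟩ := exists_rowSum_pos a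
      [(fun r => if r + 1 < j + 1 then (j + 1) * t else 0, j + 1),
        (fun r => (((((j + 1) * (B - s)) • ({j} : Multiset ℕ)).filter (r + 1 ≤ ·)).card),
          (j + 1) * ((B - s + s - 1) / s))]
      (by
        intro q hq
        simp only [List.mem_cons, List.mem_nil_iff, or_false] at hq
        rcases hq with rfl | rfl
        · exact ⟨mu₁, hmu₁, hpos₁⟩
        · exact ⟨mu₂, hmu₂, hpos₂⟩)
    have e : (List.map Prod.snd [((fun r => if r + 1 < j + 1 then (j + 1) * t else 0), j + 1),
        ((fun r => (((((j + 1) * (B - s)) • ({j} : Multiset ℕ)).filter (r + 1 ≤ ·)).card)),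
          (j + 1) * ((B - s + s - 1) / s))]).sum = (j + 1) * ((B + s - 1) / s) := by
      simp only [List.map_cons, List.map_nil, List.sum_cons, List.sum_nil, add_zero]
      rw [ceilDiv_succ hs1 hB]; ring
    let mu' : Nat.Partition (a * ((j + 1) * ((B + s - 1) / s))) :=
      ⟨mu.parts, mu.parts_pos, by rw [mu.parts_sum, e]⟩
    have hsp : mu'.sortedParts = mu.sortedParts := sortedParts_congr_parts rfl
    refine ⟨mu', fun r => ?_, ?_⟩
    · rw [hsp, hmu r]
      simp only [List.map_cons, List.map_nil, List.sum_cons, List.sum_nil, add_zero]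
      rw [card_filter_nsmul_singleton, card_filter_nsmul_singleton]
      by_cases h : r + 1 ≤ j
      · rw [if_pos (by omega), if_pos h, if_pos h, ← Nat.mul_add, htB]
      · rw [if_neg (by omega), if_neg h, if_neg h]
    · rwa [kroneckerCoeff_congr_parts (congrArg (a * ·) e) (lam := mu) (lam' := mu')
        (mu' := Nat.Partition.rectangle a ((j + 1) * ((B + s - 1) / s)))
        (nu' := Nat.Partition.rectangle a ((j + 1) * ((B + s - 1) / s))) rfl (by rw [e]) (by rw [e])]
        at hpos

/-- **The whole bulk**: the blocks of all column lengths `1 ≤ j ≤ L` (`L + 1 ≤ a`) side by side,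
realised against `a × W_bulk`, `W_bulk = Σ_j (j+1)⌈B_j/⌊a/(j+1)⌋⌉` (IP, proof of Thm. 4.6: the
summands (I), (II) added over `k` with the semigroup property).
[cite: IkenmeyerPanova2017, Thm. 4.6 (proof, eqs. (I), (II) and their assembly; held: Thm. 23, pp. 11–12)] -/
theorem exists_allBulk_pos (hsq : ikenmeyerPanova2017_square_pos) {a : ℕ} (B : ℕ → ℕ) :
    ∀ L : ℕ, L + 1 ≤ a →
      ∃ mu : Nat.Partition (a * ∑ j ∈ Finset.Ioc 0 L, (j + 1) * ((B j + a / (j + 1) - 1) / (a / (j + 1)))),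
        (∀ r, mu.sortedParts.getD (r + 1) 0 =
          ((∑ j ∈ Finset.Ioc 0 L, ((j + 1) * B j) • ({j} : Multiset ℕ)).filter (r + 1 ≤ ·)).card) ∧
        0 < kroneckerCoeff ℂ mu
          (Nat.Partition.rectangle a (∑ j ∈ Finset.Ioc 0 L, (j + 1) * ((B j + a / (j + 1) - 1) / (a / (j + 1)))))
          (Nat.Partition.rectangle a (∑ j ∈ Finset.Ioc 0 L, (j + 1) * ((B j + a / (j + 1) - 1) / (a / (j + 1))))) := by
  intro L
  induction L with
  | zero =>
    intro _
    refine ⟨⟨0, fun h => by simp at h, by simp⟩, fun r => ?_, kroneckerCoeff_pos_of_eq_zero (by simp) _ _ _⟩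
    simp [Nat.Partition.sortedParts]
  | succ L ih =>
    intro hLa
    obtain ⟨mu₁, hmu₁, hpos₁⟩ := ih (by omega)
    obtain ⟨mu₂, hmu₂, hpos₂⟩ := exists_bulk_pos hsq (j := L + 1) hLa (B (L + 1))
    obtain ⟨mu, hmu, hpos⟩ := exists_rowSum_pos a
      [(fun r => ((∑ j ∈ Finset.Ioc 0 L, ((j + 1) * B j) • ({j} : Multiset ℕ)).filter (r + 1 ≤ ·)).card,
          ∑ j ∈ Finset.Ioc 0 L, (j + 1) * ((B j + a / (j + 1) - 1) / (a / (j + 1)))),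
        (fun r => ((((L + 1 + 1) * B (L + 1)) • ({L + 1} : Multiset ℕ)).filter (r + 1 ≤ ·)).card,
          (L + 1 + 1) * ((B (L + 1) + a / (L + 1 + 1) - 1) / (a / (L + 1 + 1))))]
      (by
        intro q hq
        simp only [List.mem_cons, List.mem_nil_iff, or_false] at hq
        rcases hq with rfl | rfl
        · exact ⟨mu₁, hmu₁, hpos₁⟩
        · exact ⟨mu₂, hmu₂, hpos₂⟩)
    have e : (List.map Prod.snd
        [((fun r => ((∑ j ∈ Finset.Ioc 0 L, ((j + 1) * B j) • ({j} : Multiset ℕ)).filter (r + 1 ≤ ·)).card),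
          ∑ j ∈ Finset.Ioc 0 L, (j + 1) * ((B j + a / (j + 1) - 1) / (a / (j + 1)))),
        ((fun r => ((((L + 1 + 1) * B (L + 1)) • ({L + 1} : Multiset ℕ)).filter (r + 1 ≤ ·)).card),
          (L + 1 + 1) * ((B (L + 1) + a / (L + 1 + 1) - 1) / (a / (L + 1 + 1))))]).sum =
        ∑ j ∈ Finset.Ioc 0 (L + 1), (j + 1) * ((B j + a / (j + 1) - 1) / (a / (j + 1))) := by
      simp only [List.map_cons, List.map_nil, List.sum_cons, List.sum_nil, add_zero]
      rw [Finset.sum_Ioc_succ_top (Nat.zero_le _)]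
    let mu' : Nat.Partition (a * ∑ j ∈ Finset.Ioc 0 (L + 1), (j + 1) * ((B j + a / (j + 1) - 1) / (a / (j + 1)))) :=
      ⟨mu.parts, mu.parts_pos, by rw [mu.parts_sum, e]⟩
    have hsp : mu'.sortedParts = mu.sortedParts := sortedParts_congr_parts rfl
    refine ⟨mu', fun r => ?_, ?_⟩
    · rw [hsp, hmu r]
      simp only [List.map_cons, List.map_nil, List.sum_cons, List.sum_nil, add_zero]
      rw [Finset.sum_Ioc_succ_top (Nat.zero_le _), Multiset.filter_add, Multiset.card_add]
    · rwa [kroneckerCoeff_congr_parts (congrArg (a * ·) e) (lam := mu) (lam' := mu')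
        (mu' := Nat.Partition.rectangle a _) (nu' := Nat.Partition.rectangle a _) rfl (by rw [e])
        (by rw [e])] at hpos

end Bulk

/-! ### §3 The width bookkeeping: `M ≤ b` -/

section Width

/-- `Σ_{1 ≤ j ≤ L} (j + 1) = L(L+3)/2`. [folklore] -/
theorem two_mul_sum_Ioc_succ (L : ℕ) : 2 * ∑ j ∈ Finset.Ioc 0 L, (j + 1) = L * L + 3 * L := by
  induction L with
  | zero => simp
  | succ L ih => rw [Finset.sum_Ioc_succ_top (Nat.zero_le _), Nat.mul_add, ih]; ring

/-- The total `Σ_j (j+1) c_j = |C| + Σ C` of a multiset of naturals in `[1, L]` through its counts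
(IP, proof of Thm. 4.6: "`Σ_k k c_k = |ν| + ν₁`"). [cite: IkenmeyerPanova2017, Thm. 4.6 (proof, the bound on M; held: Thm. 23, p. 12)] -/
theorem sum_succ_mul_count (C : Multiset ℕ) {L : ℕ} (hC : ∀ x ∈ C, 1 ≤ x ∧ x ≤ L) :
    ∑ j ∈ Finset.Ioc 0 L, (j + 1) * C.count j = C.sum + C.card := by
  have hsum : C.sum = ∑ j ∈ Finset.Ioc 0 L, C.count j * j := by
    conv_lhs => rw [eq_sum_count_nsmul C hC, Multiset.sum_sum]
    simp only [Multiset.sum_nsmul, Multiset.sum_singleton, smul_eq_mul]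
  have hcard : C.card = ∑ j ∈ Finset.Ioc 0 L, C.count j := by
    conv_lhs => rw [eq_sum_count_nsmul C hC, Multiset.card_sum]
    simp only [Multiset.card_nsmul, Multiset.card_singleton, mul_one]
  rw [hsum, hcard, ← Finset.sum_add_distrib]
  exact Finset.sum_congr rfl fun j _ => by ring

/-- **The width of the bulk** (IP, proof of Thm. 4.6: "`h_k ≤ c_k/a_k = c_k/(k⌊a/k⌋) ≤ c_k/(a-k)`
… `Σ_k k h_k ≤ (|ν| + ν₁)/(a - ℓ)`", here with the ceilings kept: the `+ Σ_k k` of the printed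
`M`): with `s_j = ⌊a/(j+1)⌋` blocks to a frame and `(j+1) B_j ≤ c_j`,
`(a - ℓ) · Σ_j (j+1)⌈B_j/s_j⌉ ≤ (Σ C + |C|) + a Σ_{j ≤ L} (j+1)`.
[cite: IkenmeyerPanova2017, Thm. 4.6 (proof, the bound on M; held: Thm. 23, p. 12)] -/
theorem bulk_width_bound {a ℓ L : ℕ} (hLℓ : L + 1 ≤ ℓ) (hℓa : ℓ ≤ a) (B : ℕ → ℕ) (C : Multiset ℕ)
    (hC : ∀ x ∈ C, 1 ≤ x ∧ x ≤ L) (hB : ∀ j, (j + 1) * B j ≤ C.count j) :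
    (a - ℓ) * ∑ j ∈ Finset.Ioc 0 L, (j + 1) * ((B j + a / (j + 1) - 1) / (a / (j + 1))) ≤
      C.sum + C.card + a * ∑ j ∈ Finset.Ioc 0 L, (j + 1) := by
  rw [← sum_succ_mul_count C hC, Finset.mul_sum, Finset.mul_sum, ← Finset.sum_add_distrib]
  refine Finset.sum_le_sum fun j hj => ?_
  rw [Finset.mem_Ioc] at hj
  set k := j + 1 with hk
  set s := a / k with hs
  have hka : k ≤ a := by omega
  have hs1 : 1 ≤ s := (Nat.le_div_iff_mul_le (by omega)).2 (by simpa using hka)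
  have hdm : k * s + a % k = a := Nat.div_add_mod a k
  have hmod : a % k < k := Nat.mod_lt a (by omega)
  have hks : a - ℓ ≤ k * s := by omega
  rcases Nat.eq_zero_or_pos (B j) with h0 | hBj
  · rw [h0, Nat.zero_add, Nat.div_eq_of_lt (by omega), mul_zero, mul_zero]
    exact Nat.zero_le _
  · set F := (B j + s - 1) / s with hF
    have hsF : F * s ≤ B j + s - 1 := Nat.div_mul_le_self _ _
    calc (a - ℓ) * (k * F) = k * ((a - ℓ) * F) := by ring
      _ ≤ k * (k * s * F) := Nat.mul_le_mul_left _ (Nat.mul_le_mul_right _ hks)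
      _ = k * (k * (F * s)) := by ring
      _ ≤ k * (k * (B j + s - 1)) := Nat.mul_le_mul_left _ (Nat.mul_le_mul_left _ hsF)
      _ ≤ k * (k * B j + k * s) := by
          apply Nat.mul_le_mul_left
          rw [← Nat.mul_add]
          exact Nat.mul_le_mul_left _ (Nat.sub_le _ _)
      _ ≤ k * C.count j + a * k := by
          have h1 : k * (k * B j) ≤ k * C.count j := Nat.mul_le_mul_left _ (hB j)
          have h2 : k * (k * s) ≤ a * k := by rw [mul_comm a k]; exact Nat.mul_le_mul_left _ (by omega)
          calc k * (k * B j + k * s) = k * (k * B j) + k * (k * s) := Nat.mul_add _ _ _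
            _ ≤ k * C.count j + a * k := Nat.add_le_add h1 h2

/-- **The final count `M ≤ b`** (IP, proof of Thm. 4.6, last display: "`M ≤ (|ν|+ν₁)/(a-ℓ) +
ℓ(ℓ+1)/2 - 1 + wℓ + w ≤ … ≤ 3b/8 + (5b/2)/4 ≤ b`"), in the integer form used here: bulk width `W_B`
with `(a - ℓ) W_B ≤ 2|ν| + aT`, `2T + 2 ≤ ℓ² + ℓ`; small pieces `t + 1 ≤ ℓ² + ℓ` of them, in square
frames of side `w`, `7 ≤ w`, `w² ≤ 2ℓ + 47`, stacked `p = ⌊9ℓ/w⌋` high, of total width `W_S = w⌈t/p⌉`;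
`6|ν| ≤ ab`, `a ≥ 9ℓ`, `b ≥ 3ℓ²`, `ℓ ≥ 9`. Then `W_B + W_S ≤ b`.
[cite: IkenmeyerPanova2017, Thm. 4.6 (proof, "We want to show that M ≤ b"; held: Thm. 23, p. 12)] -/
theorem width_le {ℓ a b S T WB WS t w p : ℕ} (hℓ : 9 ≤ ℓ) (ha : 9 * ℓ ≤ a) (hb : 3 * ℓ ^ 2 ≤ b)
    (hS : 6 * S ≤ a * b) (hWB : (a - ℓ) * WB ≤ 2 * S + a * T) (hT : 2 * T + 2 ≤ ℓ * ℓ + ℓ)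
    (ht : t + 1 ≤ ℓ * ℓ + ℓ) (hw7 : 7 ≤ w) (hw2 : w * w ≤ 2 * ℓ + 47) (hp : p = 9 * ℓ / w)
    (hWS : WS = w * ((t + p - 1) / p)) : WB + WS ≤ b := by
  have ha0 : 0 < a := by omega
  -- the bulk: `8 W_B ≤ 3b + 9T`
  have h1 : 8 * WB ≤ 3 * b + 9 * T := by
    have h9 : 8 * a ≤ 9 * (a - ℓ) := by omega
    have h2 : 8 * a * WB ≤ 9 * (2 * S) + 9 * (a * T) :=
      calc 8 * a * WB ≤ 9 * (a - ℓ) * WB := Nat.mul_le_mul_right _ h9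
        _ = 9 * ((a - ℓ) * WB) := by ring
        _ ≤ 9 * (2 * S + a * T) := Nat.mul_le_mul_left _ hWB
        _ = 9 * (2 * S) + 9 * (a * T) := by ring
    have h3 : 9 * (2 * S) ≤ 3 * (a * b) := by omega
    have h4 : a * (8 * WB) ≤ a * (3 * b + 9 * T) :=
      calc a * (8 * WB) = 8 * a * WB := by ring
        _ ≤ 3 * (a * b) + 9 * (a * T) := by omega
        _ = a * (3 * b + 9 * T) := by ring
    exact Nat.le_of_mul_le_mul_left h4 ha0
  -- the small pieces: `8 W_S ≤ 2ℓ² + 58ℓ + 47`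
  have hwℓ : w ≤ ℓ := by nlinarith
  have hw0 : 0 < w := by omega
  have hwp : w * p ≤ 9 * ℓ := by rw [hp, mul_comm w (9 * ℓ / w)]; exact Nat.div_mul_le_self _ _
  have hwp' : 9 * ℓ < w * p + w := by rw [hp, mul_comm w (9 * ℓ / w)]; exact Nat.lt_div_mul_add hw0
  have hp1 : 1 ≤ p := by
    by_contra h0
    have : p = 0 := by omega
    rw [this] at hwp'; omega
  have hpF : (t + p - 1) / p * p ≤ t + p - 1 := Nat.div_mul_le_self _ _
  have h4 : 8 * ℓ * WS ≤ (2 * ℓ + 47) * t + 9 * ℓ * ℓ := by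
    have h5 : 8 * ℓ + 1 ≤ w * p := by omega
    calc 8 * ℓ * WS ≤ w * p * WS := Nat.mul_le_mul_right _ (by omega)
      _ = w * w * ((t + p - 1) / p * p) := by rw [hWS]; ring
      _ ≤ w * w * (t + p - 1) := Nat.mul_le_mul_left _ hpF
      _ ≤ w * w * t + w * (w * p) := by
          rcases Nat.eq_zero_or_pos t with rfl | ht0
          · simp only [mul_zero, zero_add]
            calc w * w * (p - 1) ≤ w * w * p := Nat.mul_le_mul_left _ (Nat.sub_le _ _)
              _ = w * (w * p) := by ring
          · have e : t + p - 1 = t + (p - 1) := by omega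
            rw [e, Nat.mul_add]
            apply Nat.add_le_add_left
            calc w * w * (p - 1) ≤ w * w * p := Nat.mul_le_mul_left _ (Nat.sub_le _ _)
              _ = w * (w * p) := by ring
      _ ≤ (2 * ℓ + 47) * t + w * (9 * ℓ) :=
          Nat.add_le_add (Nat.mul_le_mul_right _ hw2) (Nat.mul_le_mul_left _ hwp)
      _ ≤ (2 * ℓ + 47) * t + 9 * ℓ * ℓ := by nlinarith
  have h6 : 8 * WS ≤ (2 * ℓ + 47) * (ℓ + 1) + 9 * ℓ := by
    have hℓ0 : 0 < ℓ := by omega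
    have : (2 * ℓ + 47) * t ≤ (2 * ℓ + 47) * (ℓ * ℓ + ℓ) := Nat.mul_le_mul_left _ (by omega)
    have h7 : ℓ * (8 * WS) ≤ ℓ * ((2 * ℓ + 47) * (ℓ + 1) + 9 * ℓ) :=
      calc ℓ * (8 * WS) = 8 * ℓ * WS := by ring
        _ ≤ (2 * ℓ + 47) * (ℓ * ℓ + ℓ) + 9 * ℓ * ℓ := by omega
        _ = ℓ * ((2 * ℓ + 47) * (ℓ + 1) + 9 * ℓ) := by ring
    exact Nat.le_of_mul_le_mul_left h7 hℓ0
  -- together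
  have hsq : ℓ ^ 2 = ℓ * ℓ := sq ℓ
  rw [hsq] at hb
  nlinarith

end Width

/-! ### §4 IP Thm. 4.6 from the square positivity and the printed computations -/

section Main

/-- `L² + 3L + 2 ≤ ℓ² + ℓ` for `L + 1 ≤ ℓ`. [folklore] -/
theorem sq_bound_aux {L ℓ : ℕ} (hLℓ : L + 1 ≤ ℓ) : L * L + 3 * L + 2 ≤ ℓ * ℓ + ℓ := by nlinarith

/-- The side `w` of the common square frame of the small pieces: `w = max(7, ⌊√(L+8)⌋ + 1)` has
`w ≥ 7`, `w² > L + 8` and `w² ≤ 2L + 49`. [folklore] -/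
theorem smallFrame_bounds (L : ℕ) :
    7 ≤ max 7 (Nat.sqrt (L + 8) + 1) ∧ L + 8 < max 7 (Nat.sqrt (L + 8) + 1) * max 7 (Nat.sqrt (L + 8) + 1) ∧
      max 7 (Nat.sqrt (L + 8) + 1) * max 7 (Nat.sqrt (L + 8) + 1) ≤ 2 * L + 49 := by
  set q := Nat.sqrt (L + 8) with hq
  have h1 : L + 8 < (q + 1) * (q + 1) := Nat.lt_succ_sqrt (L + 8)
  have h2 : q * q ≤ L + 8 := Nat.sqrt_le (L + 8)
  refine ⟨le_max_left _ _, ?_, ?_⟩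
  · exact lt_of_lt_of_le h1 (Nat.mul_le_mul (le_max_right _ _) (le_max_right _ _))
  · rcases le_or_gt (q + 1) 7 with h | h
    · rw [max_eq_left h]; omega
    · rw [max_eq_right h.le]
      nlinarith

/-- **Ikenmeyer–Panova, Adv. Math. 319 (2017), Thm. 4.6 (held arXiv text: Thm. 23) — the main
positivity theorem — from the square positivity and the printed computer calculations.** "Let
`ν ∉ 𝔛` and `ℓ = max(ℓ(ν) + 1, 9)`, `a > 3ℓ^{3/2}`, `b ≥ 3ℓ²` and `|ν| ≤ ab/6`. Then
`g(ν(ab), a × b, a × b) > 0`" (the tree's named fact `ikenmeyerPanova2017_thm_4_6`), PROVED from: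

* `hsq` — the square positivity `g(k × k, k × k, k × k) > 0` of Bessenrodt–Behns quoted in IP §1.1
  (the tree's named fact `ikenmeyerPanova2017_square_pos`; used through Lemma 4.2);
* the finitely many Kronecker coefficients of `S₄₉` which the printed proof declares "verified by
  direct computation" / "a finite calculation shows", in the frame `7 × 7`, for shapes given by a new
  first row over a group of columns (`(A.filter (r+1 ≤ ·)).card` boxes in row `r + 1`):
  - `hbad23`: every group of two or three columns of the lengths `1, 2, 4, 6` other than `{1, 2}`
    (shape `(3,1)ᵀ… = (2,1)`) and `{1, 1, 2}` (shape `(3,1)`) — these are the shapes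
    `(hw - j - |ρ|, 1^j + ρ)`, `j ≤ 6`, `|ρ| ≤ 6` of Cor. 4.5 ("For all values of `j ≤ 6` … we verify
    computationally the statement with `h = w = 7`") together with the remainders `ρ` of cases (1),
    (3), (5) of Lemma 4.1 in the proof of Thm. 4.6 ("In cases (1), (3), (4), and (5) a finite
    calculation shows that `g(ρ(49), 7 × 7, 7 × 7) > 0`");
  - `hbad4`: the six further groups `{1,1,1,2}, {1,2,2,2}, {1,1,1,1,2}` (bodies `(4,1)`, `(4,3)`,
    `(5,1)`: cases (5), (3), (4) of Lemma 4.1) and `{3,4}, {3,6}, {5,6}` (bodies `(2,2,2,1)`,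
    `(2,2,2,1,1,1)`, `(2⁵,1)`: Cor. 4.5 with `j < ℓ(ρ)`, "already treated computationally");
  - `hfam1, hfam11, hfam1111, hfam111111, hfam21`: the base cases `a = 7` of Prop. 4.3 for the five
    `ρ ∈ 𝔛 ∖ {(3,1)}` of Cor. 4.5 (i)–(iv) and "for all other ρ" ("we can apply Proposition 4.3 with
    initial condition `a = 7`, which is verified computationally"): columns `{1, j}` for
    `j ∈ [1,46] ∖ {2,45}`, `{2, j}` for `j ∈ [2,45] ∖ {44}`, `{4, j}` for `j ∈ [4,43]`, `{6, j}` for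
    `j ∈ [6,41]`, `{1, 2, j}` for `j ∈ [2,43]`.

Everything else of the printed §4 is proved in the tree: the semigroup and transposition
properties, Lemma 4.2 (`ikenmeyerPanova2017_lemma_4_2_of_square_pos`), Prop. 4.3
(`ikenmeyerPanova2017_prop_4_3`), Cor. 4.4 with its base case derived (`ikenmeyerPanova2017_cor_4_4`),
Cor. 4.5 beyond the base (`ikenmeyerPanova2017_cor_4_5_fam*`), and here Lemma 4.1 with the
assembly of Thm. 4.6: the columns of `ν` are cut into blocks of `j+1` columns of length `j`
realised against frames `a × (j+1)` (Lemma 4.2, `⌊a/(j+1)⌋` blocks to a frame), and a remainder of at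
most `ℓ² + ℓ - 1` columns split into the atoms above (`exists_atom_decomposition`), each realised
against `w × w`, `w = max(7, ⌊√(ℓ(ν)+8)⌋+1)`, and stacked `⌊9ℓ/w⌋` to a frame `a × w`; the widths add up
to at most `b` (`width_le`: `3b/8 + …`, as in print). The printed decomposition is followed in
substance (greedy blocks keeping one block's worth of columns, pairs, good columns as hooks, the
exceptional remainders merged with a further column or block); the bookkeeping differs in that all
small pieces are treated uniformly. [cite: IkenmeyerPanova2017, Thm. 4.6 (held: Thm. 23, pp. 11–12), with Lemma 4.1, Lemma 4.2, Cor. 4.4, Cor. 4.5] -/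
theorem ikenmeyerPanova2017_thm_4_6_of_computations (hsq : ikenmeyerPanova2017_square_pos)
    (hbad23 : ∀ A : Multiset ℕ, (∀ x ∈ A, x = 1 ∨ x = 2 ∨ x = 4 ∨ x = 6) →
      (A.card = 2 ∨ A.card = 3) → A ≠ {1, 2} → A ≠ {1, 1, 2} → ∀ lam : Nat.Partition (7 * 7),
        (∀ r, lam.sortedParts.getD (r + 1) 0 = (A.filter (r + 1 ≤ ·)).card) →
        0 < kroneckerCoeff ℂ lam (Nat.Partition.rectangle 7 7) (Nat.Partition.rectangle 7 7))
    (hbad4 : ∀ A ∈ ([{1, 1, 1, 2}, {1, 2, 2, 2}, {1, 1, 1, 1, 2}, {3, 4}, {3, 6}, {5, 6}] :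
        List (Multiset ℕ)), ∀ lam : Nat.Partition (7 * 7),
        (∀ r, lam.sortedParts.getD (r + 1) 0 = (A.filter (r + 1 ≤ ·)).card) →
        0 < kroneckerCoeff ℂ lam (Nat.Partition.rectangle 7 7) (Nat.Partition.rectangle 7 7))
    (hfam1 : ∀ j, 1 ≤ j → j ≤ 46 → j ≠ 2 → j ≠ 45 → ∀ lam : Nat.Partition (7 * 7),
      (∀ r, lam.sortedParts.getD (r + 1) 0 = (({1, j} : Multiset ℕ).filter (r + 1 ≤ ·)).card) →
      0 < kroneckerCoeff ℂ lam (Nat.Partition.rectangle 7 7) (Nat.Partition.rectangle 7 7))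
    (hfam11 : ∀ j, 2 ≤ j → j ≤ 45 → j ≠ 44 → ∀ lam : Nat.Partition (7 * 7),
      (∀ r, lam.sortedParts.getD (r + 1) 0 = (({2, j} : Multiset ℕ).filter (r + 1 ≤ ·)).card) →
      0 < kroneckerCoeff ℂ lam (Nat.Partition.rectangle 7 7) (Nat.Partition.rectangle 7 7))
    (hfam1111 : ∀ j, 4 ≤ j → j ≤ 43 → ∀ lam : Nat.Partition (7 * 7),
      (∀ r, lam.sortedParts.getD (r + 1) 0 = (({4, j} : Multiset ℕ).filter (r + 1 ≤ ·)).card) →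
      0 < kroneckerCoeff ℂ lam (Nat.Partition.rectangle 7 7) (Nat.Partition.rectangle 7 7))
    (hfam111111 : ∀ j, 6 ≤ j → j ≤ 41 → ∀ lam : Nat.Partition (7 * 7),
      (∀ r, lam.sortedParts.getD (r + 1) 0 = (({6, j} : Multiset ℕ).filter (r + 1 ≤ ·)).card) →
      0 < kroneckerCoeff ℂ lam (Nat.Partition.rectangle 7 7) (Nat.Partition.rectangle 7 7))
    (hfam21 : ∀ j, 2 ≤ j → j ≤ 43 → ∀ lam : Nat.Partition (7 * 7),
      (∀ r, lam.sortedParts.getD (r + 1) 0 = (({1, 2, j} : Multiset ℕ).filter (r + 1 ≤ ·)).card) →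
      0 < kroneckerCoeff ℂ lam (Nat.Partition.rectangle 7 7) (Nat.Partition.rectangle 7 7)) :
    ikenmeyerPanova2017_thm_4_6 := by
  intro a b lam hX ha hb hsize
  -- the columns of the body
  obtain ⟨C, hCrows, hCmem, hCsum, hCcard, hCX⟩ := exists_cols_of_shape lam
  have hCX' := hCX hX
  -- empty body: `λ = (ab)`
  by_cases hC0 : C = 0
  · refine kroneckerCoeff_pos_of_frame_le (c := a) (d := 0) ⟨0, fun h => by simp at h, by simp⟩
      (kroneckerCoeff_pos_of_eq_zero (by simp) _ _ _) le_rfl (Nat.zero_le b) lam fun r => ?_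
    rw [← hCrows r, hC0]
    simp [Nat.Partition.sortedParts]
  -- the cut into bulk and small pieces
  obtain ⟨B, Small, hsplit, hSmall0, hSmallX, hSmallL, hSmallcard, hBcount⟩ :=
    exists_blocks_small C hCmem hC0 hCX'
  -- the parameters `L = ℓ(ν)`, `ℓ`, `w`, `p`
  generalize hL : Multiset.card (body lam) = L at ha hb hCmem hsplit hSmallL hSmallcard
  obtain ⟨ℓ, hℓ⟩ : ∃ ℓ, max (L + 1) 9 = ℓ := ⟨_, rfl⟩
  have hℓ9 : 9 ≤ ℓ := hℓ ▸ le_max_right _ _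
  have hLℓ : L + 1 ≤ ℓ := hℓ ▸ le_max_left _ _
  rw [hℓ] at ha hb
  have ha9 : 9 * ℓ + 1 ≤ a := by
    by_contra h
    have h' : a ≤ 9 * ℓ := by omega
    have : a ^ 2 ≤ 9 * ℓ ^ 3 :=
      calc a ^ 2 ≤ (9 * ℓ) ^ 2 := Nat.pow_le_pow_left h' 2
        _ = 81 * ℓ ^ 2 := by ring
        _ ≤ 9 * ℓ * ℓ ^ 2 := Nat.mul_le_mul_right _ (by omega)
        _ = 9 * ℓ ^ 3 := by ring
    omega
  obtain ⟨w, hw⟩ : ∃ w, max 7 (Nat.sqrt (L + 8) + 1) = w := ⟨_, rfl⟩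
  obtain ⟨hw7, hwL, hw2⟩ := hw ▸ smallFrame_bounds L
  have hwℓ : w ≤ ℓ := by nlinarith
  obtain ⟨p, hp⟩ : ∃ p, 9 * ℓ / w = p := ⟨_, rfl⟩
  have hwp : w * p ≤ 9 * ℓ := by rw [← hp, mul_comm w (9 * ℓ / w)]; exact Nat.div_mul_le_self _ _
  have hwp' : 9 * ℓ < w * p + w := by
    rw [← hp, mul_comm w (9 * ℓ / w)]; exact Nat.lt_div_mul_add (by omega)
  have hp1 : 1 ≤ p := by
    rcases Nat.eq_zero_or_pos p with h0 | h0
    · rw [h0] at hwp'; omega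
    · exact h0
  have hpa : w * p ≤ a := by omega
  -- the atoms, each realised against `w × w`
  have hgood : ∀ g, 1 ≤ g → g ≤ L → g ≠ 1 → g ≠ 2 → g ≠ 4 → g ≠ 6 →
      ∃ mu : Nat.Partition (w * w),
        (∀ r, mu.sortedParts.getD (r + 1) 0 = (({g} : Multiset ℕ).filter (r + 1 ≤ ·)).card) ∧
          0 < kroneckerCoeff ℂ mu (Nat.Partition.rectangle w w) (Nat.Partition.rectangle w w) :=
    fun g hg1 hgL h1 h2 h4 h6 => exists_hook_pos_sq hw7 (by omega) h1 h2 h4 h6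
  have hR23 : ∀ A : Multiset ℕ, (∀ x ∈ A, x = 1 ∨ x = 2 ∨ x = 4 ∨ x = 6) →
      (A.card = 2 ∨ A.card = 3) → A ≠ {1, 2} → A ≠ {1, 1, 2} →
      ∃ mu : Nat.Partition (w * w),
        (∀ r, mu.sortedParts.getD (r + 1) 0 = (A.filter (r + 1 ≤ ·)).card) ∧
          0 < kroneckerCoeff ℂ mu (Nat.Partition.rectangle w w) (Nat.Partition.rectangle w w) := by
    intro A hA hAc hA12 hA112
    have hA6 : ∀ x ∈ A, 1 ≤ x ∧ x ≤ 6 := fun x hx => by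
      rcases hA x hx with rfl | rfl | rfl | rfl <;> decide
    refine exists_pos_sq_of_seven hw7 hA6 ?_ (hbad23 A hA hAc hA12 hA112)
    have hs : A.sum ≤ Multiset.card A • 6 := Multiset.sum_le_card_nsmul A 6 fun x hx => (hA6 x hx).2
    rw [smul_eq_mul] at hs
    rcases hAc with hc | hc <;> rw [hc] at hs ⊢ <;> omega
  have hR4 : (∃ mu : Nat.Partition (w * w),
        (∀ r, mu.sortedParts.getD (r + 1) 0 = (({1, 1, 1, 2} : Multiset ℕ).filter (r + 1 ≤ ·)).card) ∧
          0 < kroneckerCoeff ℂ mu (Nat.Partition.rectangle w w) (Nat.Partition.rectangle w w)) ∧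
      (∃ mu : Nat.Partition (w * w),
        (∀ r, mu.sortedParts.getD (r + 1) 0 = (({1, 2, 2, 2} : Multiset ℕ).filter (r + 1 ≤ ·)).card) ∧
          0 < kroneckerCoeff ℂ mu (Nat.Partition.rectangle w w) (Nat.Partition.rectangle w w)) ∧
      (∃ mu : Nat.Partition (w * w),
        (∀ r, mu.sortedParts.getD (r + 1) 0 =
          (({1, 1, 1, 1, 2} : Multiset ℕ).filter (r + 1 ≤ ·)).card) ∧
          0 < kroneckerCoeff ℂ mu (Nat.Partition.rectangle w w) (Nat.Partition.rectangle w w)) :=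
    ⟨exists_pos_sq_of_seven hw7 (L := 2) (by decide) (by decide) (hbad4 {1, 1, 1, 2} (by simp)),
      exists_pos_sq_of_seven hw7 (L := 2) (by decide) (by decide) (hbad4 {1, 2, 2, 2} (by simp)),
      exists_pos_sq_of_seven hw7 (L := 2) (by decide) (by decide) (hbad4 {1, 1, 1, 1, 2} (by simp))⟩
  have hRmix : (∃ mu : Nat.Partition (w * w),
        (∀ r, mu.sortedParts.getD (r + 1) 0 = (({3, 4} : Multiset ℕ).filter (r + 1 ≤ ·)).card) ∧
          0 < kroneckerCoeff ℂ mu (Nat.Partition.rectangle w w) (Nat.Partition.rectangle w w)) ∧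
      (∃ mu : Nat.Partition (w * w),
        (∀ r, mu.sortedParts.getD (r + 1) 0 = (({3, 6} : Multiset ℕ).filter (r + 1 ≤ ·)).card) ∧
          0 < kroneckerCoeff ℂ mu (Nat.Partition.rectangle w w) (Nat.Partition.rectangle w w)) ∧
      (∃ mu : Nat.Partition (w * w),
        (∀ r, mu.sortedParts.getD (r + 1) 0 = (({5, 6} : Multiset ℕ).filter (r + 1 ≤ ·)).card) ∧
          0 < kroneckerCoeff ℂ mu (Nat.Partition.rectangle w w) (Nat.Partition.rectangle w w)) :=
    ⟨exists_pos_sq_of_seven hw7 (L := 6) (by decide) (by decide) (hbad4 {3, 4} (by simp)),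
      exists_pos_sq_of_seven hw7 (L := 6) (by decide) (by decide) (hbad4 {3, 6} (by simp)),
      exists_pos_sq_of_seven hw7 (L := 6) (by decide) (by decide) (hbad4 {5, 6} (by simp))⟩
  have hRf1 : ∀ g, 3 ≤ g → g ≤ L → g ≠ 4 → g ≠ 6 → ∃ mu : Nat.Partition (w * w),
      (∀ r, mu.sortedParts.getD (r + 1) 0 = (({1, g} : Multiset ℕ).filter (r + 1 ≤ ·)).card) ∧
        0 < kroneckerCoeff ℂ mu (Nat.Partition.rectangle w w) (Nat.Partition.rectangle w w) := by
    intro g hg3 hgL hg4 hg6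
    refine exists_pos_sq_of_forall (L := L) (fun x hx => ?_) ?_ fun mu hmu =>
      ikenmeyerPanova2017_cor_4_5_fam1 hfam1 hw7 (by omega) (by omega) (by omega) (by omega) mu hmu
    · simp only [Multiset.insert_eq_cons, Multiset.mem_cons, Multiset.mem_singleton] at hx
      rcases hx with rfl | rfl <;> omega
    · simp; omega
  have hRf2 : ∀ g, 3 ≤ g → g ≤ L → g ≠ 4 → g ≠ 6 → ∃ mu : Nat.Partition (w * w),
      (∀ r, mu.sortedParts.getD (r + 1) 0 = (({2, g} : Multiset ℕ).filter (r + 1 ≤ ·)).card) ∧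
        0 < kroneckerCoeff ℂ mu (Nat.Partition.rectangle w w) (Nat.Partition.rectangle w w) := by
    intro g hg3 hgL hg4 hg6
    refine exists_pos_sq_of_forall (L := L) (fun x hx => ?_) ?_ fun mu hmu =>
      ikenmeyerPanova2017_cor_4_5_fam11 hfam11 hw7 (by omega) (by omega) (by omega) mu hmu
    · simp only [Multiset.insert_eq_cons, Multiset.mem_cons, Multiset.mem_singleton] at hx
      rcases hx with rfl | rfl <;> omega
    · simp; omega
  have hRf4 : ∀ g, 5 ≤ g → g ≤ L → g ≠ 6 → ∃ mu : Nat.Partition (w * w),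
      (∀ r, mu.sortedParts.getD (r + 1) 0 = (({4, g} : Multiset ℕ).filter (r + 1 ≤ ·)).card) ∧
        0 < kroneckerCoeff ℂ mu (Nat.Partition.rectangle w w) (Nat.Partition.rectangle w w) := by
    intro g hg5 hgL hg6
    refine exists_pos_sq_of_forall (L := L) (fun x hx => ?_) ?_ fun mu hmu =>
      ikenmeyerPanova2017_cor_4_5_fam1111 hfam1111 hw7 (by omega) (by omega) mu hmu
    · simp only [Multiset.insert_eq_cons, Multiset.mem_cons, Multiset.mem_singleton] at hx
      rcases hx with rfl | rfl <;> omega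
    · simp; omega
  have hRf6 : ∀ g, 7 ≤ g → g ≤ L → ∃ mu : Nat.Partition (w * w),
      (∀ r, mu.sortedParts.getD (r + 1) 0 = (({6, g} : Multiset ℕ).filter (r + 1 ≤ ·)).card) ∧
        0 < kroneckerCoeff ℂ mu (Nat.Partition.rectangle w w) (Nat.Partition.rectangle w w) := by
    intro g hg7 hgL
    refine exists_pos_sq_of_forall (L := L) (fun x hx => ?_) ?_ fun mu hmu =>
      ikenmeyerPanova2017_cor_4_5_fam111111 hfam111111 hw7 (by omega) (by omega) mu hmu
    · simp only [Multiset.insert_eq_cons, Multiset.mem_cons, Multiset.mem_singleton] at hx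
      rcases hx with rfl | rfl <;> omega
    · simp; omega
  have hRf21 : ∀ g, 3 ≤ g → g ≤ L → g ≠ 4 → g ≠ 6 → ∃ mu : Nat.Partition (w * w),
      (∀ r, mu.sortedParts.getD (r + 1) 0 = (({1, 2, g} : Multiset ℕ).filter (r + 1 ≤ ·)).card) ∧
        0 < kroneckerCoeff ℂ mu (Nat.Partition.rectangle w w) (Nat.Partition.rectangle w w) := by
    intro g hg3 hgL hg4 hg6
    refine exists_pos_sq_of_forall (L := L) (fun x hx => ?_) ?_ fun mu hmu =>
      ikenmeyerPanova2017_cor_4_5_fam21 hfam21 hw7 (by omega) (by omega) mu hmu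
    · simp only [Multiset.insert_eq_cons, Multiset.mem_cons, Multiset.mem_singleton] at hx
      rcases hx with rfl | rfl | rfl <;> omega
    · simp; omega
  obtain ⟨G, hGsum, hGlen, hGR⟩ := exists_atom_decomposition
    (fun A => ∃ mu : Nat.Partition (w * w),
      (∀ r, mu.sortedParts.getD (r + 1) 0 = (A.filter (r + 1 ≤ ·)).card) ∧
        0 < kroneckerCoeff ℂ mu (Nat.Partition.rectangle w w) (Nat.Partition.rectangle w w))
    hgood hR23 hR4 hRmix hRf1 hRf2 hRf4 hRf6 hRf21 (Multiset.card Small) Small rfl hSmallL hSmall0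
    hSmallX
  -- the small pieces in stacks against `a × W_S`
  obtain ⟨muS, hmuS, hposS⟩ := exists_stacks_pos hp1 hpa G.length G rfl hGR
  rw [hGsum] at hmuS
  -- the bulk against `a × W_B`
  obtain ⟨muB, hmuB, hposB⟩ := exists_allBulk_pos hsq (a := a) B L (by omega)
  -- side by side
  obtain ⟨mu, hmu, hpos⟩ := exists_rowSum_pos a
    [(fun r => ((∑ j ∈ Finset.Ioc 0 L, ((j + 1) * B j) • ({j} : Multiset ℕ)).filter (r + 1 ≤ ·)).card,
        ∑ j ∈ Finset.Ioc 0 L, (j + 1) * ((B j + a / (j + 1) - 1) / (a / (j + 1)))),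
      (fun r => (Small.filter (r + 1 ≤ ·)).card, w * ((G.length + p - 1) / p))]
    (by
      intro q hq
      simp only [List.mem_cons, List.mem_nil_iff, or_false] at hq
      rcases hq with rfl | rfl
      · exact ⟨muB, hmuB, hposB⟩
      · exact ⟨muS, hmuS, hposS⟩)
  -- the width
  have hwidth : ∑ j ∈ Finset.Ioc 0 L, (j + 1) * ((B j + a / (j + 1) - 1) / (a / (j + 1))) +
      w * ((G.length + p - 1) / p) ≤ b := by
    have hWB := bulk_width_bound (a := a) hLℓ (by omega) B C hCmem hBcount
    have hT := two_mul_sum_Ioc_succ L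
    refine width_le (S := bodySize lam) (T := ∑ j ∈ Finset.Ioc 0 L, (j + 1)) (t := G.length)
      hℓ9 (by omega) hb hsize ?_ ?_ ?_ hw7 (by omega) hp.symm rfl
    · calc (a - ℓ) * ∑ j ∈ Finset.Ioc 0 L, (j + 1) * ((B j + a / (j + 1) - 1) / (a / (j + 1)))
          ≤ C.sum + C.card + a * ∑ j ∈ Finset.Ioc 0 L, (j + 1) := hWB
        _ ≤ 2 * bodySize lam + a * ∑ j ∈ Finset.Ioc 0 L, (j + 1) := by
            have : C.sum + C.card ≤ 2 * bodySize lam := by rw [hCsum]; omega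
            exact Nat.add_le_add_right this _
    · have := sq_bound_aux hLℓ; omega
    · have := sq_bound_aux hLℓ; omega
  -- conclusion
  refine kroneckerCoeff_pos_of_frame_le mu hpos le_rfl (by simpa using hwidth) lam fun r => ?_
  rw [hmu r, ← hCrows r]
  simp only [List.map_cons, List.map_nil, List.sum_cons, List.sum_nil, add_zero]
  conv_lhs => rw [hsplit, Multiset.filter_add, Multiset.card_add]
  ring

end Main

end Literature.Computability.Complexity
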